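import Summits.QuantumAdvantage.QuantumAdvantage.Theorems.CubicForrelationNearExactIsExactTwelveDigitDualForm
import Summits.QuantumAdvantage.QuantumAdvantage.Theorems.CubicForrelationNearExactIsExactTwelveDigitPairing
import Summits.QuantumAdvantage.QuantumAdvantage.Theorems.CubicForrelationNearExactIsExactCubicForm

/-!
# Crux `CubicForrelation.NearExactIsExact` (stmt-QuantumAdvantage-14043) — the PAIRING PARTNER of the digit class in tensor form ((L6) bridge)

Certificate seat `b2b-cforr-cert` (gen 40).  HONEST FRAMING: kernel-checked bookkeeping (standard axioms) — the "(L6) bridge" of the Lean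
roadmap for `E1280-even` (HOME/b2b-cforr-cert-g39/E1280-HANDPROOFS.md §3): it restates the dual form lemma (…TwelveDigitDualForm) and the
inverse pairing (…TwelveDigitPairing) of a type-O cubic `g = polyPhase p` on 12 bits in the TENSOR language consumed by the leaf files
`tpa_R2_*` / `tpa_R4_*` (cert seat g39) and by `tps_pair_covariant`.  Nothing about `θ₁₂`; NOT summit progress.

The tensors (written out in every statement; no definitions):
* `c v j k := Σ_{s ∈ supp p} [v, j, k pairwise distinct ∧ supp s = {v,j,k}]` — the coefficient of `x_v x_j x_k` in `p` (a 3-vector);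
* `d w j k := [w, j, k pairwise distinct] · N₃({w,j,k}ᶜ)` — the matching dual `C*` (a 3-form), `N₃(K)` = number of `3`-sets of monomials of `p`
  tiling `K`.
Results: `tcp_c_symm*`, `tcp_d_symm*`, `tcp_d_diag` (total symmetry, vanishing diagonals); `tcp_pair_monomial` (the double sum
`Σ_{j<k} c_{vjk} d_{wjk}` monomial by monomial); `tcp_pair` (**(PAIR)**: `Σ_{j<k} c_{vjk} d_{wjk} = [v = w]` for a type-O cubic, from
`tdp_card_saturated_four_at`, `tdp_offdiag_even` and `N₄` odd); `tcp_d_eq_third` (the 3-form `d` IS the cubic form of the digit class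
`κ = [u ≡ ±1 (mod 8)]`: `d_{wjk} = D_{e_w}D_{e_j}D_{e_k}κ(0)`, from `tdf_cube3_class` and `tcf_third_cube`).

References: this seat lineage (g33 dual form / pairing, g37 partner criterion); C. Carlet (2021) §2.2.  Axioms: the standard three.
-/

set_option linter.dupNamespace false -- D-0017: single-problem summit ⇒ `QuantumAdvantage.QuantumAdvantage` by design

noncomputable section

namespace Summit.QuantumAdvantage.QuantumAdvantage.Theorems.CubicForrelation.NearExactIsExact

open Finset
open Literature.Computability.QuantumComplexity
open Literature.Computability.QuantumComplexity.BuzetChailloux (bxor zeroVec zeroVec_bxor bxor_zeroVec)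
open Literature.Computability.QuantumComplexity.DerivativeWalsh (W)

section Bridge

variable (p : MvPolynomial (Fin (6 + 6)) (ZMod 2))

/-! ### Symmetry of the tensors -/

/-- The condition "pairwise distinct with `supp s = {v,j,k}`" is symmetric in `j, k`. [folklore] -/
theorem tcp_cond_swap23 (s : Fin (6 + 6) →₀ ℕ) (v j k : Fin (6 + 6)) :
    (v ≠ j ∧ v ≠ k ∧ j ≠ k ∧ s.support = {v, j, k}) ↔ (v ≠ k ∧ v ≠ j ∧ k ≠ j ∧ s.support = {v, k, j}) := by
  rw [Finset.pair_comm j k]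
  constructor
  · rintro ⟨a, b, c, d⟩; exact ⟨b, a, Ne.symm c, d⟩
  · rintro ⟨a, b, c, d⟩; exact ⟨b, a, Ne.symm c, d⟩

/-- … and in `v, j`. [folklore] -/
theorem tcp_cond_swap12 (s : Fin (6 + 6) →₀ ℕ) (v j k : Fin (6 + 6)) :
    (v ≠ j ∧ v ≠ k ∧ j ≠ k ∧ s.support = {v, j, k}) ↔ (j ≠ v ∧ j ≠ k ∧ v ≠ k ∧ s.support = {j, v, k}) := by
  rw [Finset.insert_comm j v {k}]
  constructor
  · rintro ⟨a, b, c, d⟩; exact ⟨Ne.symm a, c, b, d⟩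
  · rintro ⟨a, b, c, d⟩; exact ⟨Ne.symm a, c, b, d⟩

/-- `c` is symmetric in its last two indices. [folklore] -/
theorem tcp_c_symm23 (v j k : Fin (6 + 6)) :
    (∑ s ∈ p.support, (if (v ≠ k ∧ v ≠ j ∧ k ≠ j ∧ s.support = {v, k, j}) then (1 : ZMod 2) else 0)) =
      ∑ s ∈ p.support, (if (v ≠ j ∧ v ≠ k ∧ j ≠ k ∧ s.support = {v, j, k}) then (1 : ZMod 2) else 0) :=
  sum_congr rfl fun s _ => by simp only [tcp_cond_swap23 s v j k]

/-- `c` is symmetric in its first two indices. [folklore] -/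
theorem tcp_c_symm12 (v j k : Fin (6 + 6)) :
    (∑ s ∈ p.support, (if (j ≠ v ∧ j ≠ k ∧ v ≠ k ∧ s.support = {j, v, k}) then (1 : ZMod 2) else 0)) =
      ∑ s ∈ p.support, (if (v ≠ j ∧ v ≠ k ∧ j ≠ k ∧ s.support = {v, j, k}) then (1 : ZMod 2) else 0) :=
  sum_congr rfl fun s _ => by simp only [tcp_cond_swap12 s v j k]

/-- `d` is symmetric in its last two indices. [folklore] -/
theorem tcp_d_symm23 (w j k : Fin (6 + 6)) :
    (if (w ≠ k ∧ w ≠ j ∧ k ≠ j) then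
        ((#{S' ∈ p.support.powerset | #S' = 3 ∧ (S'.biUnion fun s => s.support) = ({w, k, j} : Finset _)ᶜ} : ℕ) : ZMod 2) else 0) =
      if (w ≠ j ∧ w ≠ k ∧ j ≠ k) then
        ((#{S' ∈ p.support.powerset | #S' = 3 ∧ (S'.biUnion fun s => s.support) = ({w, j, k} : Finset _)ᶜ} : ℕ) : ZMod 2) else 0 := by
  rw [Finset.pair_comm k j]
  have : (w ≠ k ∧ w ≠ j ∧ k ≠ j) ↔ (w ≠ j ∧ w ≠ k ∧ j ≠ k) := by
    constructor
    · rintro ⟨a, b, c⟩; exact ⟨b, a, Ne.symm c⟩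
    · rintro ⟨a, b, c⟩; exact ⟨b, a, Ne.symm c⟩
  simp only [this]

/-- `d` is symmetric in its first two indices. [folklore] -/
theorem tcp_d_symm12 (w j k : Fin (6 + 6)) :
    (if (j ≠ w ∧ j ≠ k ∧ w ≠ k) then
        ((#{S' ∈ p.support.powerset | #S' = 3 ∧ (S'.biUnion fun s => s.support) = ({j, w, k} : Finset _)ᶜ} : ℕ) : ZMod 2) else 0) =
      if (w ≠ j ∧ w ≠ k ∧ j ≠ k) then
        ((#{S' ∈ p.support.powerset | #S' = 3 ∧ (S'.biUnion fun s => s.support) = ({w, j, k} : Finset _)ᶜ} : ℕ) : ZMod 2) else 0 := by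
  rw [Finset.insert_comm j w {k}]
  have : (j ≠ w ∧ j ≠ k ∧ w ≠ k) ↔ (w ≠ j ∧ w ≠ k ∧ j ≠ k) := by
    constructor
    · rintro ⟨a, b, c⟩; exact ⟨Ne.symm a, c, b⟩
    · rintro ⟨a, b, c⟩; exact ⟨Ne.symm a, c, b⟩
  simp only [this]

/-- `d` vanishes on the diagonal. [folklore] -/
theorem tcp_d_diag (w j : Fin (6 + 6)) :
    (if (w ≠ j ∧ w ≠ j ∧ j ≠ j) then
        ((#{S' ∈ p.support.powerset | #S' = 3 ∧ (S'.biUnion fun s => s.support) = ({w, j, j} : Finset _)ᶜ} : ℕ) : ZMod 2) else 0) = 0 := by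
  rw [if_neg]
  rintro ⟨-, -, h⟩
  exact h rfl

/-! ### The pairing, monomial by monomial -/

/-- No `3` monomials of a cubic tile more than `9` variables. [folklore] -/
theorem tcp_tilings3_empty (hp : p.totalDegree ≤ 3) (K : Finset (Fin (6 + 6))) (hK : 9 < #K) :
    {S' ∈ p.support.powerset | #S' = 3 ∧ (S'.biUnion fun s => s.support) = K} = ∅ := by
  rw [filter_eq_empty_iff]
  rintro S' hS' ⟨h3, hU⟩
  have h9 : #(S'.biUnion fun s => s.support) ≤ 3 * #S' := ax_card_biUnion_le hp (mem_powerset.1 hS')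
  rw [hU, h3] at h9
  omega

/-- **The pairing, one monomial at a time.**  For a monomial `s` of `p` and vertices `v, w`:
`Σ_{j<k} [v,j,k distinct, supp s = {v,j,k}] · d_{wjk}` equals, if `v ∈ supp s`, `[w ∉ supp s ∖ v] · N₃((insert w (supp s ∖ v))ᶜ)`, and `0`
otherwise.  (For `|supp s| = 3` exactly one pair `j<k` qualifies; for `|supp s| ≤ 2` both sides vanish.) [this work] -/
theorem tcp_pair_monomial (hp : p.totalDegree ≤ 3) (s : Fin (6 + 6) →₀ ℕ) (hs : s ∈ p.support) (v w : Fin (6 + 6)) :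
    (∑ j, ∑ k, (if j < k then
        (if (v ≠ j ∧ v ≠ k ∧ j ≠ k ∧ s.support = {v, j, k}) then (1 : ZMod 2) else 0) *
          (if (w ≠ j ∧ w ≠ k ∧ j ≠ k) then
            ((#{S' ∈ p.support.powerset | #S' = 3 ∧ (S'.biUnion fun s => s.support) = ({w, j, k} : Finset _)ᶜ} : ℕ) : ZMod 2) else 0)
        else 0)) =
      if v ∈ s.support then
        (if w ∉ s.support.erase v then
          ((#{S' ∈ p.support.powerset | #S' = 3 ∧ (S'.biUnion fun s' => s'.support) = (insert w (s.support.erase v))ᶜ} : ℕ) : ZMod 2)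
          else 0)
      else 0 := by
  classical
  by_cases hv : v ∈ s.support
  · rw [if_pos hv]
    have h3 : #s.support ≤ 3 := ax_card_support_le hp hs
    by_cases hcard : #s.support = 3
    · -- the two other elements `j₀ < k₀`
      have hE : #(s.support.erase v) = 2 := by rw [card_erase_of_mem hv, hcard]
      obtain ⟨a, b, hab, hE2⟩ := card_eq_two.1 hE
      -- order them
      obtain ⟨j₀, k₀, hjk, hE0⟩ : ∃ j₀ k₀ : Fin (6 + 6), j₀ < k₀ ∧ s.support.erase v = {j₀, k₀} := by
        rcases lt_or_gt_of_ne hab with h | h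
        · exact ⟨a, b, h, hE2⟩
        · exact ⟨b, a, h, by rw [hE2, pair_comm]⟩
      have hj₀ : j₀ ∈ s.support.erase v := by rw [hE0]; simp
      have hk₀ : k₀ ∈ s.support.erase v := by rw [hE0]; simp
      have hvj : v ≠ j₀ := fun h => (mem_erase.1 hj₀).1 h.symm
      have hvk : v ≠ k₀ := fun h => (mem_erase.1 hk₀).1 h.symm
      have hsupp : s.support = {v, j₀, k₀} := by
        rw [← insert_erase hv, hE0]
      -- the qualifying condition picks out exactly `(j₀, k₀)`
      have hcond : ∀ j k : Fin (6 + 6), j < k → ((v ≠ j ∧ v ≠ k ∧ j ≠ k ∧ s.support = {v, j, k}) ↔ (j = j₀ ∧ k = k₀)) := by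
        intro j k hlt
        constructor
        · rintro ⟨hvj', hvk', hjk', hS⟩
          have hpair : ({j, k} : Finset (Fin (6 + 6))) = {j₀, k₀} := by
            rw [← hE0, hS]
            ext x
            simp only [mem_insert, mem_singleton, mem_erase]
            constructor
            · rintro (rfl | rfl)
              · exact ⟨fun h => hvj' h.symm, Or.inr (Or.inl rfl)⟩
              · exact ⟨fun h => hvk' h.symm, Or.inr (Or.inr rfl)⟩
            · rintro ⟨hne, rfl | rfl | rfl⟩
              · exact absurd rfl hne
              · exact Or.inl rfl
              · exact Or.inr rfl
          have hj : j ∈ ({j₀, k₀} : Finset (Fin (6 + 6))) := by rw [← hpair]; simp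
          have hk : k ∈ ({j₀, k₀} : Finset (Fin (6 + 6))) := by rw [← hpair]; simp
          simp only [mem_insert, mem_singleton] at hj hk
          rcases hj with rfl | rfl <;> rcases hk with rfl | rfl
          · exact absurd hlt (lt_irrefl _)
          · exact ⟨rfl, rfl⟩
          · exact absurd (hlt.trans hjk) (lt_irrefl _)
          · exact absurd hlt (lt_irrefl _)
        · rintro ⟨rfl, rfl⟩
          exact ⟨hvj, hvk, ne_of_lt hlt, hsupp⟩
      rw [Finset.sum_eq_single j₀, Finset.sum_eq_single k₀]
      · rw [if_pos hjk, if_pos ((hcond j₀ k₀ hjk).2 ⟨rfl, rfl⟩), one_mul, hE0]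
        have hw : (w ∉ ({j₀, k₀} : Finset (Fin (6 + 6)))) ↔ (w ≠ j₀ ∧ w ≠ k₀ ∧ j₀ ≠ k₀) := by
          simp only [mem_insert, mem_singleton, not_or]
          exact ⟨fun ⟨a, b⟩ => ⟨a, b, ne_of_lt hjk⟩, fun ⟨a, b, _⟩ => ⟨a, b⟩⟩
        simp only [hw]
      · intro k _ hk
        by_cases hlt : j₀ < k
        · rw [if_pos hlt, if_neg, zero_mul]
          intro hc
          exact hk ((hcond j₀ k hlt).1 hc).2
        · rw [if_neg hlt]
      · intro h; exact absurd (mem_univ k₀) h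
      · intro j _ hj
        refine Finset.sum_eq_zero fun k _ => ?_
        by_cases hlt : j < k
        · rw [if_pos hlt, if_neg, zero_mul]
          intro hc
          exact hj ((hcond j k hlt).1 hc).1
        · rw [if_neg hlt]
      · intro h; exact absurd (mem_univ j₀) h
    · -- `|supp s| ≤ 2`: both sides vanish
      have h2 : #s.support ≤ 2 := by omega
      have hL : (∑ j, ∑ k, (if j < k then
          (if (v ≠ j ∧ v ≠ k ∧ j ≠ k ∧ s.support = {v, j, k}) then (1 : ZMod 2) else 0) *
            (if (w ≠ j ∧ w ≠ k ∧ j ≠ k) then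
              ((#{S' ∈ p.support.powerset | #S' = 3 ∧ (S'.biUnion fun s => s.support) = ({w, j, k} : Finset _)ᶜ} : ℕ) : ZMod 2)
              else 0) else 0)) = 0 := by
        refine Finset.sum_eq_zero fun j _ => Finset.sum_eq_zero fun k _ => ?_
        by_cases hlt : j < k
        · rw [if_pos hlt, if_neg, zero_mul]
          rintro ⟨hvj, hvk, hjk', hS⟩
          have : #s.support = 3 := by
            rw [hS, card_insert_of_notMem, card_pair hjk']
            simp only [mem_insert, mem_singleton, not_or]; exact ⟨hvj, hvk⟩
          exact hcard this
        · rw [if_neg hlt]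
      rw [hL]
      by_cases hw : w ∉ s.support.erase v
      · rw [if_pos hw]
        have hbig : 9 < #(insert w (s.support.erase v))ᶜ := by
          rw [card_compl, Fintype.card_fin]
          have : #(insert w (s.support.erase v)) ≤ 2 := by
            calc #(insert w (s.support.erase v)) ≤ #(s.support.erase v) + 1 := card_insert_le _ _
              _ ≤ 2 := by rw [card_erase_of_mem hv]; omega
          omega
        rw [tcp_tilings3_empty p hp _ hbig, card_empty, Nat.cast_zero]
      · rw [if_neg hw]
  · rw [if_neg hv]
    refine Finset.sum_eq_zero fun j _ => Finset.sum_eq_zero fun k _ => ?_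
    by_cases hlt : j < k
    · rw [if_pos hlt, if_neg, zero_mul]
      rintro ⟨-, -, -, hS⟩
      apply hv; rw [hS]; simp
    · rw [if_neg hlt]

/-- **(PAIR) in tensor form.**  For a type-O cubic `g = polyPhase p` on 12 bits (`W_g = 16u`, all `u` odd):
`Σ_{j<k} c_{vjk} d_{wjk} = [v = w]` in `𝔽₂`, with `c` the cubic coefficient tensor of `p` and `d` the matching dual. [this work] -/
theorem tcp_pair (g : (Fin (6 + 6) → Bool) → Bool) (u : (Fin (6 + 6) → Bool) → ℤ) (hp : p.totalDegree ≤ 3)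
    (hrep : ∀ x, g x = polyPhase p x) (hu : ∀ x, W (fun y => signOf (g y)) x = (2 : ℝ) ^ 4 * (u x : ℝ)) (hodd : ∀ x, Odd (u x))
    (v w : Fin (6 + 6)) :
    (∑ j, ∑ k, (if j < k then
        (∑ s ∈ p.support, (if (v ≠ j ∧ v ≠ k ∧ j ≠ k ∧ s.support = {v, j, k}) then (1 : ZMod 2) else 0)) *
          (if (w ≠ j ∧ w ≠ k ∧ j ≠ k) then
            ((#{S' ∈ p.support.powerset | #S' = 3 ∧ (S'.biUnion fun s => s.support) = ({w, j, k} : Finset _)ᶜ} : ℕ) : ZMod 2) else 0)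
        else 0)) = if v = w then 1 else 0 := by
  classical
  -- swap the sums: monomial by monomial
  have hswap : (∑ j, ∑ k, (if j < k then
        (∑ s ∈ p.support, (if (v ≠ j ∧ v ≠ k ∧ j ≠ k ∧ s.support = {v, j, k}) then (1 : ZMod 2) else 0)) *
          (if (w ≠ j ∧ w ≠ k ∧ j ≠ k) then
            ((#{S' ∈ p.support.powerset | #S' = 3 ∧ (S'.biUnion fun s => s.support) = ({w, j, k} : Finset _)ᶜ} : ℕ) : ZMod 2) else 0)
        else 0)) =
      ∑ s ∈ p.support, ∑ j, ∑ k, (if j < k then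
        (if (v ≠ j ∧ v ≠ k ∧ j ≠ k ∧ s.support = {v, j, k}) then (1 : ZMod 2) else 0) *
          (if (w ≠ j ∧ w ≠ k ∧ j ≠ k) then
            ((#{S' ∈ p.support.powerset | #S' = 3 ∧ (S'.biUnion fun s => s.support) = ({w, j, k} : Finset _)ᶜ} : ℕ) : ZMod 2) else 0)
        else 0) := by
    rw [Finset.sum_comm (s := p.support) (t := (univ : Finset (Fin (6 + 6))))]
    refine sum_congr rfl fun j _ => ?_
    rw [Finset.sum_comm (s := p.support) (t := (univ : Finset (Fin (6 + 6))))]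
    refine sum_congr rfl fun k _ => ?_
    by_cases hlt : j < k
    · simp only [if_pos hlt, Finset.sum_mul]
    · simp only [if_neg hlt, Finset.sum_const_zero]
  rw [hswap, sum_congr rfl fun s hs => tcp_pair_monomial p hp s hs v w]
  by_cases hvw : v = w
  · subst hvw
    rw [if_pos rfl]
    -- diagonal: `N₄` (odd)
    have hN4 := tdp_card_saturated_four_at p hp v
    have hsum : (∑ s ∈ p.support, (if v ∈ s.support then
        (if v ∉ s.support.erase v then
          ((#{S' ∈ p.support.powerset | #S' = 3 ∧ (S'.biUnion fun s' => s'.support) = (insert v (s.support.erase v))ᶜ} : ℕ) : ZMod 2)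
          else 0) else 0)) =
        ((#{S ∈ p.support.powerset | #S = 4 ∧ (S.biUnion fun s => s.support) = univ} : ℕ) : ZMod 2) := by
      rw [hN4, Nat.cast_sum, ← Finset.sum_filter]
      refine sum_congr rfl fun s hs => ?_
      have hv : v ∈ s.support := (mem_filter.1 hs).2
      rw [if_pos (by simp), insert_erase hv]
    rw [hsum]
    -- `N₄` is odd for a type-O cubic (`cube_bias_congr` with `m = 4` on the full cube; as in `no_caseA`)
    have hbias : ∑ x ∈ {x : Fin (6 + 6) → Bool | ∀ i, x i = true → i ∈ (univ : Finset (Fin (6 + 6)))}, signOf (g x) =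
        ((∑ x ∈ {x : Fin (6 + 6) → Bool | ∀ i, x i = true → i ∈ (univ : Finset (Fin (6 + 6)))},
          ∏ s ∈ p.support, (if (∀ j ∈ s.support, x j = true) then (-1 : ℤ) else 1) : ℤ) : ℝ) := by
      rw [Int.cast_sum]
      exact sum_congr rfl fun x _ => by rw [hrep x, ax_signOf_polyPhase]
    have hpois : (2 : ℝ) ^ 4 * ∑ x ∈ {x : Fin (6 + 6) → Bool | ∀ i, x i = true → i ∈ (∅ : Finset (Fin (6 + 6)))}, (u x : ℝ) =
        (2 : ℝ) ^ #(∅ : Finset (Fin (6 + 6))) *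
          ∑ y ∈ {x : Fin (6 + 6) → Bool | ∀ i, x i = true → i ∈ (∅ : Finset (Fin (6 + 6)))ᶜ}, signOf (g y) := by
      have hP := bb_poisson (fun y => signOf (g y)) (∅ : Finset (Fin (6 + 6)))
      rw [sum_congr rfl fun x _ => hu x, ← mul_sum] at hP
      exact hP
    obtain ⟨k₄, hk₄⟩ := Summit.QuantumAdvantage.QuantumAdvantage.Theorems.NearExactIsExact.Negative.TypeOTwelve.cube_bias_congr p hp
      univ 4 (by rw [card_univ, Fintype.card_fin])
    have hE0 : #({x : Fin (6 + 6) → Bool | ∀ i, x i = true → i ∈ (∅ : Finset (Fin (6 + 6)))} : Finset _) = 1 := by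
      rw [bb_card_cube, card_empty, pow_zero]
    obtain ⟨a, ha⟩ := card_eq_one.1 hE0
    rw [ha, sum_singleton, card_empty, pow_zero, one_mul, compl_empty, hbias, hk₄] at hpois
    have h0z : (2 : ℤ) ^ 4 * u a = (-2) ^ 4 *
        (#{S ∈ p.support.powerset | #S = 4 ∧ (S.biUnion fun s => s.support) = univ} : ℕ) + 2 ^ (4 + 1) * k₄ := by
      exact_mod_cast hpois
    have hua : u a % 2 = 1 := Int.odd_iff.1 (hodd a)
    have hodd4 : #{S ∈ p.support.powerset | #S = 4 ∧ (S.biUnion fun s => s.support) = univ} % 2 = 1 := by omega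
    rw [ZMod.natCast_eq_one_iff_odd, Nat.odd_iff]
    exact hodd4
  · rw [if_neg hvw]
    -- off-diagonal: `tdp_offdiag_even`
    have heven := tdp_offdiag_even p hp v w hvw
    have hsum : (∑ s ∈ p.support, (if v ∈ s.support then
        (if w ∉ s.support.erase v then
          ((#{S' ∈ p.support.powerset | #S' = 3 ∧ (S'.biUnion fun s' => s'.support) = (insert w (s.support.erase v))ᶜ} : ℕ) : ZMod 2)
          else 0) else 0)) =
        ((∑ s ∈ p.support.filter (fun s => v ∈ s.support ∧ w ∉ s.support),
          #{S' ∈ p.support.powerset | #S' = 3 ∧ (S'.biUnion fun s => s.support) = (insert w (s.support.erase v))ᶜ} : ℕ) : ZMod 2) := by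
      rw [Nat.cast_sum, ← Finset.sum_filter]
      have hw : ∀ s : Fin (6 + 6) →₀ ℕ, (w ∉ s.support.erase v) ↔ (w ∉ s.support) := fun s => by
        rw [mem_erase, not_and_or]; push Not
        exact ⟨fun h => h.resolve_left fun e => hvw e.symm, fun h => Or.inr h⟩
      rw [← Finset.sum_filter]
      rw [Finset.filter_filter]
      refine sum_congr (filter_congr fun s _ => by rw [hw]) fun s _ => rfl
    rw [hsum]
    obtain ⟨r, hr⟩ := heven
    rw [hr, Nat.cast_add]
    exact CharTwo.add_self_eq_zero _

end Bridge

/-! ### The 3-form `d` is the cubic form of the digit class -/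

/-- **`d` is the cubic form of the digit class.**  For a type-O cubic `g = polyPhase p` on 12 bits with `W_g = 16u` and digit class
`κ = [u ≡ ±1 (mod 8)]`: for all `w, j, k`, `d_{wjk} = D_{e_w}D_{e_j}D_{e_k}κ(0)` (read in `𝔽₂`).  For distinct indices this is
`tdf_cube3_class` + `tcf_third_cube`; otherwise both sides vanish. [this work] -/
theorem tcp_d_eq_third (p : MvPolynomial (Fin (6 + 6)) (ZMod 2)) (g : (Fin (6 + 6) → Bool) → Bool) (u : (Fin (6 + 6) → Bool) → ℤ)
    (hp : p.totalDegree ≤ 3) (hrep : ∀ x, g x = polyPhase p x) (hu : ∀ x, W (fun y => signOf (g y)) x = (2 : ℝ) ^ 4 * (u x : ℝ))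
    (hodd : ∀ x, Odd (u x)) (w j k : Fin (6 + 6)) :
    let κ : (Fin (6 + 6) → Bool) → Bool := fun x => decide (u x % 8 = 1 ∨ u x % 8 = 7)
    (if (w ≠ j ∧ w ≠ k ∧ j ≠ k) then
        ((#{S' ∈ p.support.powerset | #S' = 3 ∧ (S'.biUnion fun s => s.support) = ({w, j, k} : Finset _)ᶜ} : ℕ) : ZMod 2) else 0) =
      if (((κ zeroVec ^^ κ (bxor zeroVec (fun l => decide (l = k)))) ^^
            (κ (bxor zeroVec (fun l => decide (l = j))) ^^ κ (bxor (bxor zeroVec (fun l => decide (l = j))) (fun l => decide (l = k))))) ^^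
          ((κ (bxor zeroVec (fun l => decide (l = w))) ^^ κ (bxor (bxor zeroVec (fun l => decide (l = w))) (fun l => decide (l = k)))) ^^
            (κ (bxor (bxor zeroVec (fun l => decide (l = w))) (fun l => decide (l = j))) ^^
              κ (bxor (bxor (bxor zeroVec (fun l => decide (l = w))) (fun l => decide (l = j))) (fun l => decide (l = k)))))) = true then
        (1 : ZMod 2) else 0 := by
  intro κ
  classical
  by_cases hdis : w ≠ j ∧ w ≠ k ∧ j ≠ k
  · obtain ⟨hwj, hwk, hjk⟩ := hdis
    rw [if_pos ⟨hwj, hwk, hjk⟩]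
    have hcube := tcf_third_cube κ w j k hwj hwk hjk
    rw [hcube]
    have hT : #({w, j, k} : Finset (Fin (6 + 6))) = 3 := by
      rw [card_insert_of_notMem, card_pair hjk]
      simp only [mem_insert, mem_singleton, not_or]; exact ⟨hwj, hwk⟩
    have hclass := tdf_cube3_class g p u hp hrep hu hodd {w, j, k} hT
    -- the two filters coincide
    have hfilt : ((univ.filter fun y : Fin (6 + 6) → Bool => ∀ l, y l = true → l ∈ ({w, j, k} : Finset (Fin (6 + 6)))).filter
        fun y => κ y = true) =
        {x ∈ ({x : Fin (6 + 6) → Bool | ∀ i, x i = true → i ∈ ({w, j, k} : Finset (Fin (6 + 6)))} : Finset _) |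
          u x % 8 = 1 ∨ u x % 8 = 7} := by
      refine filter_congr fun y _ => ?_
      simp only [κ, decide_eq_true_eq]
    rw [hfilt]
    have hb : ∀ m : ℕ, (if decide (Odd m) = true then (1 : ZMod 2) else 0) = (m : ZMod 2) := by
      intro m
      rcases Nat.even_or_odd m with he | ho
      · rw [if_neg (by simpa using Nat.not_odd_iff_even.2 he), (ZMod.natCast_eq_zero_iff_even).2 he]
      · rw [if_pos (by simpa using ho), (ZMod.natCast_eq_one_iff_odd).2 ho]
    rw [hb, ZMod.natCast_eq_natCast_iff']
    exact hclass.symm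
  · rw [if_neg hdis]
    -- a repeated index: the third difference vanishes
    have hrep3 : w = j ∨ w = k ∨ j = k := by
      by_contra hno
      push Not at hno
      exact hdis ⟨hno.1, hno.2.1, hno.2.2⟩
    rw [if_neg]
    rw [Bool.not_eq_true]
    rcases hrep3 with rfl | rfl | rfl
    · exact tcf_third_diag12 κ (fun l => decide (l = w)) (fun l => decide (l = k)) zeroVec
    · rw [tcf_third_swap23 κ (fun l => decide (l = w)) (fun l => decide (l = j)) (fun l => decide (l = w)) zeroVec]
      exact tcf_third_diag12 κ (fun l => decide (l = w)) (fun l => decide (l = j)) zeroVec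
    · rw [tcf_third_swap12 κ (fun l => decide (l = w)) (fun l => decide (l = j)) (fun l => decide (l = j)) zeroVec,
        tcf_third_swap23 κ (fun l => decide (l = j)) (fun l => decide (l = w)) (fun l => decide (l = j)) zeroVec]
      exact tcf_third_diag12 κ (fun l => decide (l = j)) (fun l => decide (l = w)) zeroVec

end Summit.QuantumAdvantage.QuantumAdvantage.Theorems.CubicForrelation.NearExactIsExact

end
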